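import Summits.HodgeConjecture.Ring2.LowDimensionHodgeOfMarkmanCM
import HarnessLib

/-!
# Rows `4` and `5` of the class-target axis MODULO MARKMAN'S FOURFOLD THEOREM: `HCAtDim 4`, `HCAtDim 5` and `HCUpToDim 5` are EQUIVALENT to the Hodge conjecture on three residual cells

Cell `pub-hodge-ring2` (HONEST FRAMING: research route conditional on HC_CM; not a corollary; Q11.4-sentence-2 already
refuted in dim ≥ 3), Literature lane (lit seat, generation 63, programme R35-C). Sequel of `Ring2/LowDimensionHodgeOfMarkman`
(R35) and `Ring2/LowDimensionHodgeOfMarkmanCM` (R35-B), in the vocabulary of the cell's class-target frame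
`Theorems/Ring2ClassTargets` (`HCOnClass 𝒞`, `HCAtDim g`, `HCUpToDim g`). Theorems only (no definition, no named fact, no
`sorry`); `hMark : Markman2025_weilClasses_algebraic_abelianFourfold` (the tree's existing named fact) is the only standing
hypothesis, and in §2 also Tankeev–Ribet (the tree's existing named fact
`TankeevRibet1983_hodgeClasses_divisorial_powers_simplePrimeDimension`) — both HYPOTHESES, neither discharged nor restated.

THE FRAME SO FAR. `Ring2.ClassTargets.hcUpToDim_five_of_codimTwoFacts_of_weilClassesFourfolds`: the Moonen–Zarhin codimension-2
facts (`MoonenZarhin1999_codimTwoHodgeClasses_abelianFourfold/Fivefold`, named facts) and `hMark` give `HCUpToDim 5`;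
`Ring2ClassTargetsRows.hcUpToDim_five_iff_weilClassesFourfolds`: modulo the two facts, `HCUpToDim 5` IS the Weil-fourfold cell.
THIS FILE, the other way round — modulo `hMark` and NO Moonen–Zarhin fact, how much of rows `4`, `5` is theorem:
* **`hcAtDim_four_iff_simple_nonCM_of_markman`** — `HCAtDim 4 ↔ HC(simple fourfolds NOT of CM type)` (R35 §3: every
  non-simple fourfold; CM: `CMWeights`). The residual cell is Moonen–Zarhin 1995 (simple fourfolds: types I–III incl. the
  type-III Weil planes, and the non-CM Weil type), in print, not in the tree.
* **`hcAtDim_five_iff_of_markman`** — `HCAtDim 5 ↔ HC(𝒞₅)` for the union `𝒞₅` of THREE cells: simple fivefolds not of CM type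
  [Tankeev–Ribet]; fivefolds with a simple fourfold isogeny factor not of CM type [Thm. 0.2 (3)–(4) with Moonen–Zarhin 1995];
  `X ∼ E² × T`, `T` a simple threefold with `dim_ℚ End⁰(T) = 2`, `End⁰(E) ↪ End⁰(T)` [Thm. 0.2 (1)] (R35-B
  `hodgeConjectureFor_of_dim_eq_five_of_markman`).
* **`hcUpToDim_five_iff_of_markman`** — `HCUpToDim 5 ↔ HC(simple non-CM fourfolds) ∧ HC(𝒞₅)`; and
  **`hcUpToDim_five_iff_of_markman_of_tankeevRibet`** — granted Tankeev–Ribet as well, the first cell of `𝒞₅` closes.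
* on path: the summit `HodgeConjecture` gives every cell (`ClassTargets.hcOnClass_of_hodgeConjecture`).
Nothing here discharges `hMark` or Tankeev–Ribet; «`↔`» is an equivalence of TARGETS, no cell is decided.

## References
* [MoonenZarhin1999LowDim] B. Moonen, Yu. Zarhin, Math. Ann. 315 (1999) 711–733: Thm. 0.1, Thm. 0.2, §2 Thm. (2.7)
  [corpus: paper:arxiv-math_9901113 p0001–p0002]. [cite: MoonenZarhin1999LowDim, Thm. 0.1, Thm. 0.2 and §2 Thm. (2.7)]
* [Tankeev1983] S. G. Tankeev, *Cycles on simple abelian varieties of prime dimension*, Math. USSR Izv. 20 (1983).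
  [cite: Tankeev1983, main theorem]
* [Ribet1983] K. A. Ribet, *Hodge classes on certain types of abelian varieties*, Amer. J. Math. 105 (1983), Thms. 0–3.
  [cite: Ribet1983, Thms. 0–3]
* [Markman2025SurveySecant] E. Markman, arXiv:2509.23403, Thm. 1.2 and Cor. 1.3. [claim: Markman2025SurveySecant, status: under-review]
* [Deligne2000] P. Deligne, *The Hodge conjecture* (Clay, 2000), §1. [cite: Deligne2000, §1]
-/

noncomputable section

open CategoryTheory CategoryTheory.Limits

namespace Summit.HodgeConjecture.Ring2.LowDimOfMarkman

open Literature.AlgebraicGeometry.Motives (AbelianVariety)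
open Literature.AlgebraicGeometry.Motives.AbelianVariety
open Literature.AlgebraicGeometry.HodgeTheory
open Literature.AlgebraicGeometry.ComplexMultiplication
open Literature.AlgebraicGeometry.Milne1999
open Summit.HodgeConjecture.CorCM.Domination
open Summit.HodgeConjecture.CorCM.CMWeights (hodgeConjectureFor_of_isOfCMType_dim_le_five_of_markman)
open Summit.HodgeConjecture.HodgeConjecture.Ring2.ClassTargets

/-! ### §1 Rows `4` and `5` modulo Markman -/

/-- **Row `4` modulo Markman is its simple non-CM cell**: `HCAtDim 4 ↔ HC(simple complex abelian fourfolds not of CM type)`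
(non-simple fourfolds: R35 `hodgeConjectureFor_of_dim_eq_four_of_not_isSimple_of_markman`; simple CM fourfolds:
`CMWeights.hodgeConjectureFor_of_isOfCMType_dim_le_five_of_markman`). [cite: MoonenZarhin1999LowDim, Thm. 0.1]
[claim: Markman2025SurveySecant, status: under-review] -/
theorem hcAtDim_four_iff_simple_nonCM_of_markman (hMark : Markman2025_weilClasses_algebraic_abelianFourfold) :
    HCAtDim 4 ↔ HCOnClass fun A => A.dim = 4 ∧ A.IsSimple ∧ ¬ IsOfCMType A := by
  refine ⟨fun h => hcOnClass_mono (fun A hA => hA.1) h, fun h A hA4 => ?_⟩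
  by_cases hs : A.IsSimple
  · by_cases hcm : IsOfCMType A
    · exact hodgeConjectureFor_of_isOfCMType_dim_le_five_of_markman hMark A hcm (le_of_eq_of_le hA4 (by norm_num))
    · exact h A ⟨hA4, hs, hcm⟩
  · exact hodgeConjectureFor_of_dim_eq_four_of_not_isSimple_of_markman hMark hA4 hs

/-- **Row `5` modulo Markman is the union of three cells**: `HCAtDim 5 ↔ HC(𝒞₅)`, `𝒞₅` = simple fivefolds not of CM type
∪ fivefolds with a simple fourfold isogeny factor not of CM type ∪ the row `E² × T` with `dim_ℚ End⁰(T) = 2`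
(R35-B `hodgeConjectureFor_of_dim_eq_five_of_markman`). [cite: MoonenZarhin1999LowDim, Thm. 0.2 and §2 Thm. (2.7)]
[claim: Markman2025SurveySecant, status: under-review] -/
theorem hcAtDim_five_iff_of_markman (hMark : Markman2025_weilClasses_algebraic_abelianFourfold) :
    HCAtDim 5 ↔ HCOnClass fun A => A.dim = 5 ∧ ((A.IsSimple ∧ ¬ IsOfCMType A) ∨
      (∃ F : AbelianVariety ℂ, F.IsSimple ∧ F.dim = 4 ∧ ¬ IsOfCMType F ∧ AVDominatedBy F A) ∨
      (∃ E T : AbelianVariety ℂ, E.dim = 1 ∧ IsOfCMType E ∧ T.IsSimple ∧ T.dim = 3 ∧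
        Module.finrank ℚ T.endAlgebra = 2 ∧ Nonempty (E.endAlgebra →+* T.endAlgebra) ∧
        AbelianVariety.IsIsogenous A (E.prod (E.prod T)))) := by
  refine ⟨fun h => hcOnClass_mono (fun A hA => hA.1) h, fun h A hA5 => ?_⟩
  by_cases h1 : A.IsSimple ∧ ¬ IsOfCMType A
  · exact h A ⟨hA5, Or.inl h1⟩
  by_cases h2 : ∃ F : AbelianVariety ℂ, F.IsSimple ∧ F.dim = 4 ∧ ¬ IsOfCMType F ∧ AVDominatedBy F A
  · exact h A ⟨hA5, Or.inr (Or.inl h2)⟩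
  by_cases h3 : ∃ E T : AbelianVariety ℂ, E.dim = 1 ∧ IsOfCMType E ∧ T.IsSimple ∧ T.dim = 3 ∧
      Module.finrank ℚ T.endAlgebra = 2 ∧ Nonempty (E.endAlgebra →+* T.endAlgebra) ∧
      AbelianVariety.IsIsogenous A (E.prod (E.prod T))
  · exact h A ⟨hA5, Or.inr (Or.inr h3)⟩
  exact hodgeConjectureFor_of_dim_eq_five_of_markman hMark hA5 (fun hs => by_contra fun hcm => h1 ⟨hs, hcm⟩)
    (fun F hFs hF4 hFA => by_contra fun hcm => h2 ⟨F, hFs, hF4, hcm, hFA⟩) h3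

/-- **`HCUpToDim 5` modulo Markman**: the Hodge conjecture for all complex abelian varieties of dimension `≤ 5` is
EQUIVALENT, granted `hMark`, to the Hodge conjecture on the simple non-CM fourfolds and on `𝒞₅` (dimension `≤ 3` is the
tree's unconditional `hcUpToDim_three`). [cite: MoonenZarhin1999LowDim, Thm. 0.1 and Thm. 0.2] [claim: Markman2025SurveySecant, status: under-review] -/
theorem hcUpToDim_five_iff_of_markman (hMark : Markman2025_weilClasses_algebraic_abelianFourfold) :
    HCUpToDim 5 ↔ (HCOnClass fun A => A.dim = 4 ∧ A.IsSimple ∧ ¬ IsOfCMType A) ∧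
      HCOnClass fun A => A.dim = 5 ∧ ((A.IsSimple ∧ ¬ IsOfCMType A) ∨
        (∃ F : AbelianVariety ℂ, F.IsSimple ∧ F.dim = 4 ∧ ¬ IsOfCMType F ∧ AVDominatedBy F A) ∨
        (∃ E T : AbelianVariety ℂ, E.dim = 1 ∧ IsOfCMType E ∧ T.IsSimple ∧ T.dim = 3 ∧
          Module.finrank ℚ T.endAlgebra = 2 ∧ Nonempty (E.endAlgebra →+* T.endAlgebra) ∧
          AbelianVariety.IsIsogenous A (E.prod (E.prod T)))) := by
  rw [hcUpToDim_succ_iff 4, hcUpToDim_succ_iff 3, hcAtDim_four_iff_simple_nonCM_of_markman hMark,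
    hcAtDim_five_iff_of_markman hMark]
  exact ⟨fun h => ⟨h.1.2, h.2⟩, fun h => ⟨⟨hcUpToDim_three, h.1⟩, h.2⟩⟩

/-! ### §2 Granted Tankeev–Ribet as well: the simple fivefold cell closes -/

/-- **Row `5` modulo Markman AND Tankeev–Ribet**: `HCAtDim 5 ↔ HC(𝒞₅')`, `𝒞₅'` = fivefolds with a simple fourfold isogeny
factor not of CM type ∪ the row `E² × T` with `dim_ℚ End⁰(T) = 2` (simple fivefolds: the tree's
`ClassTargets.hcOnClass_simple_primeDim_of_tankeevRibet`). [cite: MoonenZarhin1999LowDim, Thm. 0.2 and §2 Thm. (2.7)]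
[cite: Tankeev1983, main theorem] [cite: Ribet1983, Thms. 0–3] [claim: Markman2025SurveySecant, status: under-review] -/
theorem hcAtDim_five_iff_of_markman_of_tankeevRibet (hMark : Markman2025_weilClasses_algebraic_abelianFourfold)
    (hTR : TankeevRibet1983_hodgeClasses_divisorial_powers_simplePrimeDimension) :
    HCAtDim 5 ↔ HCOnClass fun A => A.dim = 5 ∧
      ((∃ F : AbelianVariety ℂ, F.IsSimple ∧ F.dim = 4 ∧ ¬ IsOfCMType F ∧ AVDominatedBy F A) ∨
      (∃ E T : AbelianVariety ℂ, E.dim = 1 ∧ IsOfCMType E ∧ T.IsSimple ∧ T.dim = 3 ∧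
        Module.finrank ℚ T.endAlgebra = 2 ∧ Nonempty (E.endAlgebra →+* T.endAlgebra) ∧
        AbelianVariety.IsIsogenous A (E.prod (E.prod T)))) := by
  rw [hcAtDim_five_iff_of_markman hMark]
  refine ⟨fun h => hcOnClass_mono (fun A hA => ⟨hA.1, Or.inr hA.2⟩) h, fun h A hA => ?_⟩
  rcases hA.2 with hs | hrest
  · exact hcOnClass_simple_primeDim_of_tankeevRibet hTR A ⟨hs.1, by rw [hA.1]; norm_num⟩
  · exact h A ⟨hA.1, hrest⟩

/-- **`HCUpToDim 5` modulo Markman and Tankeev–Ribet** ↔ HC on the simple non-CM fourfolds and on `𝒞₅'`.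
[cite: MoonenZarhin1999LowDim, Thm. 0.1, Thm. 0.2 and §2 Thm. (2.7)] [claim: Markman2025SurveySecant, status: under-review] -/
theorem hcUpToDim_five_iff_of_markman_of_tankeevRibet (hMark : Markman2025_weilClasses_algebraic_abelianFourfold)
    (hTR : TankeevRibet1983_hodgeClasses_divisorial_powers_simplePrimeDimension) :
    HCUpToDim 5 ↔ (HCOnClass fun A => A.dim = 4 ∧ A.IsSimple ∧ ¬ IsOfCMType A) ∧
      HCOnClass fun A => A.dim = 5 ∧
        ((∃ F : AbelianVariety ℂ, F.IsSimple ∧ F.dim = 4 ∧ ¬ IsOfCMType F ∧ AVDominatedBy F A) ∨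
        (∃ E T : AbelianVariety ℂ, E.dim = 1 ∧ IsOfCMType E ∧ T.IsSimple ∧ T.dim = 3 ∧
          Module.finrank ℚ T.endAlgebra = 2 ∧ Nonempty (E.endAlgebra →+* T.endAlgebra) ∧
          AbelianVariety.IsIsogenous A (E.prod (E.prod T)))) := by
  rw [hcUpToDim_succ_iff 4, hcUpToDim_succ_iff 3, hcAtDim_four_iff_simple_nonCM_of_markman hMark,
    hcAtDim_five_iff_of_markman_of_tankeevRibet hMark hTR]
  exact ⟨fun h => ⟨h.1.2, h.2⟩, fun h => ⟨⟨hcUpToDim_three, h.1⟩, h.2⟩⟩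

/-! ### §3 On path -/

/-- **On path**: the summit statement `HodgeConjecture` gives every class target of this file (through the cell's
`ClassTargets.hcOnClass_of_hodgeConjecture`) — the residual cells are CASES of the summit. [cite: Deligne2000, §1] -/
theorem residualCells_of_hodgeConjecture (h : _root_.HodgeConjecture) :
    (HCOnClass fun A => A.dim = 4 ∧ A.IsSimple ∧ ¬ IsOfCMType A) ∧
      HCOnClass fun A => A.dim = 5 ∧ ((A.IsSimple ∧ ¬ IsOfCMType A) ∨
        (∃ F : AbelianVariety ℂ, F.IsSimple ∧ F.dim = 4 ∧ ¬ IsOfCMType F ∧ AVDominatedBy F A) ∨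
        (∃ E T : AbelianVariety ℂ, E.dim = 1 ∧ IsOfCMType E ∧ T.IsSimple ∧ T.dim = 3 ∧
          Module.finrank ℚ T.endAlgebra = 2 ∧ Nonempty (E.endAlgebra →+* T.endAlgebra) ∧
          AbelianVariety.IsIsogenous A (E.prod (E.prod T)))) :=
  ⟨hcOnClass_of_hodgeConjecture _ h, hcOnClass_of_hodgeConjecture _ h⟩

end Summit.HodgeConjecture.Ring2.LowDimOfMarkman

end
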